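import Literature.AlgebraicGeometry.AbelianSchemes.DualPairOfGluedHatUnique
import Literature.AlgebraicGeometry.AbelianSchemes.RigidifyAlongUnitSlice
import HarnessLib

/-!
# (Z3) FILE P-b, letter (R): RE-RIGIDIFICATION of the glued Poincaré sheaf keeps the chart Poincaré sheaves

Layer `Literature/AlgebraicGeometry/AbelianSchemes`, namespace `Literature.AlgebraicGeometry.AbelianSchemes.AbelianSchemeOver`.
THEOREMS ONLY (no definition, no named fact, no instance, no notation, no `sorry`).  Cell hodgecm-mathlib (D-0151), FLOOR 0 P1
sub-line `Cruxes/HDel/Lines/F3DualAbelianScheme.lean` stub (Z) `stub_F3Z`; FILE P-b letter (R) of the skeleton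
`B-provers/B-p06/g14/F3/DualPairOfGluedHat.SKELETON-v3-2sorry.B-p06g14.lean` (B-p06 (g14)), discharged here.

[MumfordFogartyKirwan1994, Ch. 6 §2 (p. 121)]: the universal sheaf is «normalized so that the sheaf induced on `X̂` via `ε × 1_{X̂}`
is `𝒪_{X̂}`»; [MilneAV2008, I §8 proof of 8.4]: replace `ℒ` by `ℒ ⊗ pr^*(ℒ|_{{0} × T})⁻¹` — ★ `AbelianSchemeOver.rigidify`.  SETTING as in
★-shaped `DualPairOfGluedHatUnique` (hat `H` with cartesian charts `χᵢ`, product charts `Ξᵢ = prodChart i`, chart dual pairs `Eᵢ`).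

* `unitSlice_comp_prodChart` — the unit slice of the chart maps to the unit slice: `(ε_{Aᵢ} × 1_{Êᵢ}) ≫ Ξᵢ = χᵢ ≫ (ε_A × 1_H)`;
* `cechPic_pullback_unitSlice_detClass_P_eq_one` — the class of a chart Poincaré sheaf dies on `ε × 1` (field `rigid` of ★ `DualPair`);
* `nonempty_pullback_prodChart_rigidify_iso` — if `Ξᵢ^*P ≅ 𝒫ᵢ` then `Ξᵢ^*(rigidify P) ≅ 𝒫ᵢ`: the twist
  `Ξᵢ^* pr_H^* ((ε × 1)^*P)^∨ = pr^* ((ε_{Aᵢ} × 1)^* Ξᵢ^*P)^∨ ≅ pr^*((ε_{Aᵢ} × 1)^*𝒫ᵢ)^∨ ≅ 𝒪` (determinant classes in `Ȟ¹(·, 𝒪^×)`, the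
  pattern of ★ `nonempty_pullback_whiskerLeft_rigidify_iso`);
* **`exists_rigidified_of_charts`** — letter (R): `P′ := rigidify P` has rank one (★ `hasRank_rigidify`), is rigidified along `ε_A × 1_H`
  (★ `nonempty_pullback_unitSlice_rigidify_iso`) and has the same chart pull-backs.

HC_CM is proved only modulo the 7 printed citations until rung 0 closes; this file discharges none of them (count-neutral capital).

## References
* [MumfordFogartyKirwan1994] D. Mumford, J. Fogarty, F. Kirwan, *Geometric Invariant Theory*, 3rd ed. (1994), Ch. 6 §2 (p. 121).
* [MilneAV2008] J. S. Milne, *Abelian Varieties* (v2.00, 2008), I §8 pp. 36–37.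
* [Hartshorne1977] R. Hartshorne, *Algebraic Geometry* (1977), II Ex. 6.8, III Ex. 4.5 (`Pic = Ȟ¹(𝒪^×)`).
-/

set_option autoImplicit false

-- `Scheme.Modules` / the `Over`-monoidal carriers are not reducible (as in ★ `RigidifyAlongUnitSlice`).
set_option backward.isDefEq.respectTransparency false

noncomputable section

universe u

open CategoryTheory CategoryTheory.Limits AlgebraicGeometry MonoidalCategory
open Literature.AlgebraicGeometry.Motives Literature.AlgebraicGeometry.AbelianVarieties Literature.AlgebraicGeometry.Modules

namespace Literature.AlgebraicGeometry.AbelianSchemes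

namespace AbelianSchemeOver

variable {S : Scheme.{u}} (A : AbelianSchemeOver S) (𝒰 : Scheme.OpenCover.{u} S)
  (E : ∀ i, (A.baseChange (𝒰.f i)).DualPair) (H : AbelianSchemeOver S) (χ : ∀ i, (E i).hat.X.left ⟶ H.X.left)
  (hχ : ∀ i, (E i).hat.IsBaseChangeVia H (𝒰.f i) (χ i))

/-- **The unit slice of the chart maps to the unit slice**: `(ε_{Aᵢ} × 1_{Êᵢ}) ≫ Ξᵢ = χᵢ ≫ (ε_A × 1_H)` (components: in `A` through
★ `unitSection_baseChange_comp_fst` and `χᵢ ≫ π_H = π̂ᵢ ≫ (Uᵢ → S)`; in `H` both are `χᵢ`). [cite: MumfordFogartyKirwan1994, Ch. 6 §2 (p. 121)] -/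
@[reassoc]
theorem unitSlice_comp_prodChart (i : 𝒰.I₀) :
    (A.baseChange (𝒰.f i)).unitSlice (E i).hat ≫ A.prodChart 𝒰 E H χ hχ i = χ i ≫ A.unitSlice H := by
  have w : χ i ≫ H.X.hom = (E i).hat.X.hom ≫ 𝒰.f i := (hχ i).fst
  apply pullback.hom_ext
  · rw [Category.assoc, prodChart_fst, unitSlice_fst_assoc, Category.assoc, unitSlice_fst, unitSection_baseChange_comp_fst,
      reassoc_of% w]
  · rw [Category.assoc, prodChart_snd, unitSlice_snd_assoc, Category.assoc, unitSlice_snd, Category.comp_id]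

/-- **The class of a chart Poincaré sheaf dies on `ε_{Aᵢ} × 1_{Êᵢ}`** (the `rigid` field of ★ `DualPair`, read in `Ȟ¹(Êᵢ, 𝒪^×)`).
[cite: MumfordFogartyKirwan1994, Ch. 6 §2 (p. 121)] [cite: Hartshorne1977, III Ex. 4.5] -/
theorem cechPic_pullback_unitSlice_detClass_P_eq_one (i : 𝒰.I₀) (h : IsFiniteLocallyFree (E i).P) :
    CechPic.pullback ((A.baseChange (𝒰.f i)).unitSlice (E i).hat) (detClass h) = 1 := by
  obtain ⟨r⟩ := (E i).rigid
  rw [← detClass_pullback (hE := h), detClass_eq_of_iso r (h.pullback _) (HasRank.isFiniteLocallyFree' hasRank_unitModule)]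
  exact detClass_unitModule_eq_one _

/-- **`Ξᵢ^*(rigidify P) ≅ 𝒫ᵢ` whenever `Ξᵢ^*P ≅ 𝒫ᵢ`**: the twist `pr_H^*((ε_A × 1_H)^*P)^∨` pulls back along `Ξᵢ` to
`pr^*((ε_{Aᵢ} × 1)^* Ξᵢ^* P)^∨ ≅ pr^*((ε_{Aᵢ} × 1)^*𝒫ᵢ)^∨`, whose class is `1` (`cechPic_pullback_unitSlice_detClass_P_eq_one`); rank-one modules with
equal classes are isomorphic (★ `nonempty_iso_iff_detClass_eq`).  Pattern of ★ `nonempty_pullback_whiskerLeft_rigidify_iso`.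
[cite: MumfordFogartyKirwan1994, Ch. 6 §2 (p. 121)] [cite: Hartshorne1977, II Ex. 6.8 and III Ex. 4.5] -/
theorem nonempty_pullback_prodChart_rigidify_iso (P : (A.prodLeft H).Modules) (hP1 : HasRank P 1) (i : 𝒰.I₀)
    (c : Nonempty ((Scheme.Modules.pullback (A.prodChart 𝒰 E H χ hχ i)).obj P ≅ (E i).P)) :
    Nonempty ((Scheme.Modules.pullback (A.prodChart 𝒰 E H χ hχ i)).obj (A.rigidify H P) ≅ (E i).P) := by
  obtain ⟨e⟩ := c
  have hP₁ := HasRank.isFiniteLocallyFree' hP1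
  have hR := hasRank_rigidify (A := A) (B := H) hP1
  have hR₁ := HasRank.isFiniteLocallyFree' hR
  have hE₁ := HasRank.isFiniteLocallyFree' (E i).hasRank_one
  -- `Ξᵢ^*[P] = [𝒫ᵢ]`
  have h1 : CechPic.pullback (A.prodChart 𝒰 E H χ hχ i) (detClass hP₁) = detClass hE₁ :=
    (detClass_pullback (f := A.prodChart 𝒰 E H χ hχ i) (hE := hP₁)).symm.trans (detClass_eq_of_iso e _ _)
  -- `Ξᵢ ≫ pr_H ≫ (ε_A × 1_H) = pr ≫ (ε_{Aᵢ} × 1) ≫ Ξᵢ`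
  have hcomp : A.prodChart 𝒰 E H χ hχ i ≫ pullback.snd A.X.hom H.X.hom ≫ A.unitSlice H =
      pullback.snd (A.baseChange (𝒰.f i)).X.hom (E i).hat.X.hom ≫ (A.baseChange (𝒰.f i)).unitSlice (E i).hat ≫
        A.prodChart 𝒰 E H χ hχ i := by
    rw [A.unitSlice_comp_prodChart 𝒰 E H χ hχ i, prodChart_snd_assoc]
  -- the twist dies after `Ξᵢ^*`
  have h2 : CechPic.pullback (A.prodChart 𝒰 E H χ hχ i) (CechPic.pullback (pullback.snd A.X.hom H.X.hom)
      (CechPic.pullback (A.unitSlice H) (detClass hP₁))) = 1 :=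
    calc CechPic.pullback (A.prodChart 𝒰 E H χ hχ i) (CechPic.pullback (pullback.snd A.X.hom H.X.hom)
          (CechPic.pullback (A.unitSlice H) (detClass hP₁)))
        = CechPic.pullback (A.prodChart 𝒰 E H χ hχ i) (CechPic.pullback (pullback.snd A.X.hom H.X.hom ≫ A.unitSlice H)
            (detClass hP₁)) := by rw [CechPic.pullback_comp]
      _ = CechPic.pullback (A.prodChart 𝒰 E H χ hχ i ≫ pullback.snd A.X.hom H.X.hom ≫ A.unitSlice H) (detClass hP₁) :=
            (CechPic.pullback_comp _ _ _).symm
      _ = CechPic.pullback (pullback.snd (A.baseChange (𝒰.f i)).X.hom (E i).hat.X.hom ≫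
            (A.baseChange (𝒰.f i)).unitSlice (E i).hat ≫ A.prodChart 𝒰 E H χ hχ i) (detClass hP₁) :=
            congrArg (fun m => CechPic.pullback m (detClass hP₁)) hcomp
      _ = CechPic.pullback (pullback.snd (A.baseChange (𝒰.f i)).X.hom (E i).hat.X.hom)
            (CechPic.pullback ((A.baseChange (𝒰.f i)).unitSlice (E i).hat)
              (CechPic.pullback (A.prodChart 𝒰 E H χ hχ i) (detClass hP₁))) :=
            (CechPic.pullback_comp _ _ _).trans (congrArg _ (CechPic.pullback_comp _ _ _))
      _ = 1 := by rw [h1, A.cechPic_pullback_unitSlice_detClass_P_eq_one 𝒰 E i hE₁, map_one]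
  refine (nonempty_iso_iff_detClass_eq (hasRank_pullback _ hR) (E i).hasRank_one (hR₁.pullback _) hE₁).2 ?_
  erw [detClass_pullback (hE := hR₁), detClass_rigidify hP1 hR₁, map_mul, map_inv, h1, h2, inv_one, mul_one]

/-- **Letter (R) — RE-RIGIDIFICATION**: from a rank-one `P` on `A ×_S H` with the chart Poincaré sheaves as chart pull-backs, the module
`P′ := rigidify P` (★ `AbelianSchemeOver.rigidify`, [MumfordFogartyKirwan1994] Ch. 6 §2) has rank one (★ `hasRank_rigidify`), is
RIGIDIFIED along `ε_A × 1_H` (★ `nonempty_pullback_unitSlice_rigidify_iso`) and has the SAME chart pull-backs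
(`nonempty_pullback_prodChart_rigidify_iso`). [cite: MumfordFogartyKirwan1994, Ch. 6 §2 (p. 121)] [cite: MilneAV2008, I §8 pp. 36–37] -/
theorem exists_rigidified_of_charts (P : (A.prodLeft H).Modules) (h1 : HasRank P 1)
    (hP : ∀ i, Nonempty ((Scheme.Modules.pullback (A.prodChart 𝒰 E H χ hχ i)).obj P ≅ (E i).P)) :
    ∃ P' : (A.prodLeft H).Modules, HasRank P' 1 ∧
      Nonempty ((Scheme.Modules.pullback (A.unitSlice H)).obj P' ≅ SheafOfModules.unit _) ∧
      ∀ i, Nonempty ((Scheme.Modules.pullback (A.prodChart 𝒰 E H χ hχ i)).obj P' ≅ (E i).P) :=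
  ⟨A.rigidify H P, hasRank_rigidify h1, nonempty_pullback_unitSlice_rigidify_iso h1,
    fun i => A.nonempty_pullback_prodChart_rigidify_iso 𝒰 E H χ hχ P h1 i (hP i)⟩

end AbelianSchemeOver

end Literature.AlgebraicGeometry.AbelianSchemes

end
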